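import Summits.RiemannHypothesis.RiemannHypothesis.Theses.WeilComb
import Summits.RiemannHypothesis.RiemannHypothesis.Theorems.WeilCombCombShapePositivityStubGram
import Summits.RiemannHypothesis.RiemannHypothesis.Theorems.WeilCombCombShapePositivityFejerOfCrux
import Summits.RiemannHypothesis.RiemannHypothesis.Theorems.WeilCombCombShapeDetection
import Literature.NumberTheory.LFunctions.WeilExplicit

/-!
# `stub_fejer` (C⁺) of line `Sketch` in the convolution-square representation, and its closed
equivalence with the Riemann hypothesis
(item stmt-RiemannHypothesis-11229, crux `WeilComb.CombShapePositivity`, route route-RiemannHypothesis-WeilComb)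

Notation: `φ₀(u) = expNegInvGlue (1 - u²)`, `φ_ε(t) = ε⁻¹ φ₀(t/ε)`, `ψ_ε = φ_ε ⋆ φ̃_ε`,
`τ_x h = weilTranslate h x`, `w_ε(x) = W(τ_x ψ_ε)` (comb symbol), `Q(g) = weilQuadratic g = W(g ⋆ g̃)`,
`χ_θ(d) = exp(i Σ_{p∈S} θ_p v_p(d))`, `N = ∏_{p∈S} p^n`.

* `weilQuadratic_nodeComb_eq_sum` — Gram identity on an ARBITRARY finite node set `T ⊆ ℕ_{≥1}`:
  `Q(Σ_{m∈T} c_m φ_ε(· − log m)) = Σ_{m,m'∈T} c_m conj c_{m'} w_ε(log m − log m')`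
  (zero-extension of the coefficients to the box `[1, max T]` and `stub_gram`); the form needed by lacunary /
  divisor / S-unit restrictions of the crux.
* `fejer_sum_eq_weilQuadratic_divisorComb` — the CONVOLUTION-SQUARE REPRESENTATION of the Fejér mean:
  `Σ_{d,d' ∣ N} χ_θ(d) conj χ_θ(d') w_ε(log d − log d') = W(G ⋆ G̃)`, `G = Σ_{d ∣ N} χ_θ(d) φ_ε(· − log d)`.
  So `stub_fejer` asks for `0 ≤ Re W(G ⋆ G̃)` on the divisor-box combs: Weil positivity on convolution squares.
* `fejer_iff_riemannHypothesis` — the registered signature of `stub_fejer` is equivalent to Mathlib's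
  `RiemannHypothesis`, with NO hypothesis left (`fejer_iff_riemannHypothesis_of_detection` composed with the
  proved support item `combShapeDetection_proof`). Consequently no proof of `stub_fejer` short of a proof of RH
  exists; its unconditional corner is `fejer_subcritical` (`ε N ≤ c₀`), and every co-final family of cells is
  already the whole statement (`combShapePositivity_iff_cofinal`).
-/

noncomputable section

-- the sub-problem path RiemannHypothesis/RiemannHypothesis duplicates a namespace (D-0017)
set_option linter.dupNamespace false

open scoped BigOperators ComplexConjugate
open Complex

namespace Summit.RiemannHypothesis.RiemannHypothesis.Theorems.WeilCombFejerConvSquare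

open Literature.NumberTheory.LFunctions
open Summit.RiemannHypothesis.RiemannHypothesis.Theses.WeilComb
open Summit.RiemannHypothesis.RiemannHypothesis.Theorems.WeilCombBohrFejer

/-- A finite set of positive integers lies in the box `[1, T.sup id]`. [folklore] -/
private theorem subset_Icc_sup {T : Finset ℕ} (hT : 0 ∉ T) : T ⊆ Finset.Icc 1 (T.sup id) := by
  intro m hm
  refine Finset.mem_Icc.2 ⟨Nat.pos_of_ne_zero fun h => hT (h ▸ hm), ?_⟩
  exact Finset.le_sup (f := id) hm

/-- **Gram identity on an arbitrary finite node set.** For `ε > 0` and a finite set `T` of positive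
integers, the Weil quadratic functional of the node comb `Σ_{m∈T} c_m φ_ε(· − log m)` is the Hermitian form
of the comb symbol on the nodes: `Σ_{m,m'∈T} c_m conj c_{m'} W(τ_{log m − log m'} ψ_ε)`. [folklore] -/
theorem weilQuadratic_nodeComb_eq_sum {ε : ℝ} (hε : 0 < ε) {T : Finset ℕ} (hT : 0 ∉ T) (c : ℕ → ℂ) :
    weilQuadratic (fun x : ℝ => ∑ m ∈ T,
        c m * ((ε : ℂ)⁻¹ * ((expNegInvGlue (1 - ((x - Real.log (m : ℝ)) / ε) ^ 2) : ℝ) : ℂ))) =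
      ∑ m ∈ T, ∑ m' ∈ T,
        c m * conj (c m') *
          weilFunctional (weilTranslate
            (weilConv (fun t : ℝ => (ε : ℂ)⁻¹ * ((expNegInvGlue (1 - (t / ε) ^ 2) : ℝ) : ℂ))
              (weilReflect (fun t : ℝ => (ε : ℂ)⁻¹ * ((expNegInvGlue (1 - (t / ε) ^ 2) : ℝ) : ℂ))))
            (Real.log (m : ℝ) - Real.log (m' : ℝ))) := by
  classical
  set M : ℕ := T.sup id with hM_def
  have hsub : T ⊆ Finset.Icc 1 M := subset_Icc_sup hT
  have hfilter : (Finset.Icc 1 M).filter (· ∈ T) = T := by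
    ext m
    simp only [Finset.mem_filter]
    exact ⟨fun h => h.2, fun h => ⟨hsub h, h⟩⟩
  -- the comb symbol, as a function of the two nodes
  set W : ℕ → ℕ → ℂ := fun m m' => weilFunctional (weilTranslate
      (weilConv (fun t : ℝ => (ε : ℂ)⁻¹ * ((expNegInvGlue (1 - (t / ε) ^ 2) : ℝ) : ℂ))
        (weilReflect (fun t : ℝ => (ε : ℂ)⁻¹ * ((expNegInvGlue (1 - (t / ε) ^ 2) : ℝ) : ℂ))))
      (Real.log (m : ℝ) - Real.log (m' : ℝ))) with hW_def
  -- zero-extend the coefficients to the box `[1, M]`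
  set a : ℕ → ℂ := fun m => if m ∈ T then c m else 0 with ha_def
  have hcomb : (fun x : ℝ => ∑ m ∈ T,
        c m * ((ε : ℂ)⁻¹ * ((expNegInvGlue (1 - ((x - Real.log (m : ℝ)) / ε) ^ 2) : ℝ) : ℂ))) =
      fun x : ℝ => ∑ m ∈ Finset.Icc 1 M,
        a m * ((ε : ℂ)⁻¹ * ((expNegInvGlue (1 - ((x - Real.log (m : ℝ)) / ε) ^ 2) : ℝ) : ℂ)) := by
    funext x
    rw [← hfilter, Finset.sum_filter]
    refine Finset.sum_congr rfl fun m _ => ?_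
    by_cases h : m ∈ T
    · rw [if_pos h, ha_def]
      simp only [if_pos h]
    · rw [if_neg h, ha_def]
      simp only [if_neg h, zero_mul]
  rw [hcomb, stub_gram ε hε M a]
  -- fold the box double sum back to `T × T`
  show (∑ m ∈ Finset.Icc 1 M, ∑ m' ∈ Finset.Icc 1 M, a m * conj (a m') * W m m') =
    ∑ m ∈ T, ∑ m' ∈ T, c m * conj (c m') * W m m'
  rw [← hfilter]
  simp only [Finset.sum_filter]
  refine Finset.sum_congr rfl fun m _ => ?_
  by_cases h1 : m ∈ T
  · rw [if_pos h1]
    refine Finset.sum_congr rfl fun m' _ => ?_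
    by_cases h2 : m' ∈ T
    · rw [if_pos h2, ha_def]
      simp only [if_pos h1, if_pos h2]
    · rw [if_neg h2, ha_def]
      simp only [if_neg h2, map_zero, mul_zero, zero_mul]
  · rw [if_neg h1]
    refine Finset.sum_eq_zero fun m' _ => ?_
    rw [ha_def]
    simp only [if_neg h1, zero_mul]

/-- **Convolution-square representation of the Fejér mean.** For `ε > 0`, a finite set `S ⊆ ℕ`
(of primes, in the stub), `n` and `θ`, with `N = ∏_{p∈S} p^n` and the Bohr character `χ_θ(d) = exp(i Σ_p θ_p v_p(d))`:
`Σ_{d,d' ∣ N} χ_θ(d) conj χ_θ(d') W(τ_{log d − log d'} ψ_ε) = W(G ⋆ G̃) = Q(G)` for the divisor comb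
`G = Σ_{d ∣ N} χ_θ(d) φ_ε(· − log d)`. Thus C⁺ (`stub_fejer`) is Weil positivity `0 ≤ Re W(G ⋆ G̃)` on the
divisor-box combs. [folklore] -/
theorem fejer_sum_eq_weilQuadratic_divisorComb {ε : ℝ} (hε : 0 < ε) (S : Finset ℕ) (n : ℕ)
    (θ : ℕ → ℝ) :
    (∑ d ∈ (∏ p ∈ S, p ^ n).divisors, ∑ d' ∈ (∏ p ∈ S, p ^ n).divisors,
      Complex.exp (I * ((∑ p ∈ S, θ p * (d.factorization p : ℝ) : ℝ) : ℂ)) *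
        conj (Complex.exp (I * ((∑ p ∈ S, θ p * (d'.factorization p : ℝ) : ℝ) : ℂ))) *
        weilFunctional (weilTranslate
          (weilConv (fun t : ℝ => (ε : ℂ)⁻¹ * ((expNegInvGlue (1 - (t / ε) ^ 2) : ℝ) : ℂ))
            (weilReflect (fun t : ℝ => (ε : ℂ)⁻¹ * ((expNegInvGlue (1 - (t / ε) ^ 2) : ℝ) : ℂ))))
          (Real.log (d : ℝ) - Real.log (d' : ℝ)))) =
      weilQuadratic (fun x : ℝ => ∑ d ∈ (∏ p ∈ S, p ^ n).divisors,
        Complex.exp (I * ((∑ p ∈ S, θ p * (d.factorization p : ℝ) : ℝ) : ℂ)) *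
          ((ε : ℂ)⁻¹ * ((expNegInvGlue (1 - ((x - Real.log (d : ℝ)) / ε) ^ 2) : ℝ) : ℂ))) := by
  exact (weilQuadratic_nodeComb_eq_sum hε (T := (∏ p ∈ S, p ^ n).divisors)
    (fun h => absurd (Nat.pos_of_mem_divisors h) (lt_irrefl 0))
    (fun d => Complex.exp (I * ((∑ p ∈ S, θ p * (d.factorization p : ℝ) : ℝ) : ℂ)))).symm

/-- **`stub_fejer` is the Riemann hypothesis.** The registered signature of the stub C⁺ of line `Sketch`
(Fejér means of the comb symbol nonnegative on every torus `T^S`, every `ε > 0`) is equivalent to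
`RiemannHypothesis`, unconditionally: `fejer_iff_riemannHypothesis_of_detection` with the detection support
item discharged by `combShapeDetection_proof`. [folklore] -/
theorem fejer_iff_riemannHypothesis :
    (∀ ε : ℝ, 0 < ε → ∀ S : Finset ℕ, (∀ p ∈ S, p.Prime) → ∀ (n : ℕ) (θ : ℕ → ℝ),
      0 ≤ (∑ d ∈ (∏ p ∈ S, p ^ n).divisors, ∑ d' ∈ (∏ p ∈ S, p ^ n).divisors,
        Complex.exp (I * ((∑ p ∈ S, θ p * (d.factorization p : ℝ) : ℝ) : ℂ)) *
          conj (Complex.exp (I * ((∑ p ∈ S, θ p * (d'.factorization p : ℝ) : ℝ) : ℂ))) *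
          weilFunctional (weilTranslate
            (weilConv (fun t : ℝ => (ε : ℂ)⁻¹ * ((expNegInvGlue (1 - (t / ε) ^ 2) : ℝ) : ℂ))
              (weilReflect (fun t : ℝ => (ε : ℂ)⁻¹ * ((expNegInvGlue (1 - (t / ε) ^ 2) : ℝ) : ℂ))))
            (Real.log (d : ℝ) - Real.log (d' : ℝ)))).re) ↔
      RiemannHypothesis :=
  fejer_iff_riemannHypothesis_of_detection
    Summit.RiemannHypothesis.RiemannHypothesis.Theorems.combShapeDetection_proof

/-- **Each cell of `stub_fejer` under RH, in the convolution-square form**: RH gives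
`0 ≤ Re Q(G)` for the divisor comb `G` (Weil positivity under RH; `G` is a Weil test). [folklore] -/
theorem weilQuadratic_divisorComb_re_nonneg_of_riemannHypothesis (hRH : RiemannHypothesis) {ε : ℝ}
    (hε : 0 < ε) {S : Finset ℕ} (hS : ∀ p ∈ S, p.Prime) (n : ℕ) (θ : ℕ → ℝ) :
    0 ≤ (weilQuadratic (fun x : ℝ => ∑ d ∈ (∏ p ∈ S, p ^ n).divisors,
        Complex.exp (I * ((∑ p ∈ S, θ p * (d.factorization p : ℝ) : ℝ) : ℂ)) *
          ((ε : ℂ)⁻¹ * ((expNegInvGlue (1 - ((x - Real.log (d : ℝ)) / ε) ^ 2) : ℝ) : ℂ)))).re := by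
  rw [← fejer_sum_eq_weilQuadratic_divisorComb hε S n θ]
  exact fejer_of_riemannHypothesis hRH ε hε S hS n θ

end Summit.RiemannHypothesis.RiemannHypothesis.Theorems.WeilCombFejerConvSquare

end
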